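import Summits.HodgeConjecture.CorCM.Census.OcticWeilFourfold
import HarnessLib

/-!
# `B × E`, `B` a simple CM fourfold of Weil type (`k`-signature `(2,2)`), `E` the CM curve of `k`: the GENERATING PARTS
# of a balanced configuration (conjugate pairs, Weil `4`-sets of `B`) and the induction principle

COR-CM (cell `pub-hodgecm2`), seat b30 gen 19 (2026-08-21); count-neutral own lane OCTIC-WEIL22; sequel of
`Census/OcticWeilFourfold.lean` (the 10-point model under `2`-transitivity, `ModelBalanced₂`, the defect law).
Bookkeeping definition (`IsWeil₂Part`) and theorems of a finite model; no named fact, no geometry, no `sorry`.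

By the defect law (`exists_defect₂_of_modelBalanced₂`: `N(inl true) = N(inl false)` and `N(inr (a,true)) −
N(inr (a,false)) = t` for one integer `t` and all four `a`) a non-empty balanced configuration `T` of a product of copies
of `B`, `E` contains
* a **pair part** (`Census/OcticCurveFourfoldParts.IsPairPart`, reused: two points over a conjugate pair of labels
  `{y, cj y}` — a divisor weight, possibly spread over two copies) if `t = 0`, or
* a **Weil part** `IsWeil₂Part v b G`: four points, one over each fourfold label `(a, b)` of the sign `b` of `t` — a lift,
  spread over up to four copies of `B`, of the weight `Σ_a [(a, b)]` of the Weil line `⋀⁴ H¹(B)_b ⊆ W_k(B) ⊗ ℂ`,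
and removing it leaves a balanced configuration (`ModelBalanced₂.sdiff`); whence the INDUCTION PRINCIPLE
`modelBalanced₂_induction`: every balanced configuration is a disjoint union of pair parts and Weil parts (geometrically,
downstream: its weight line is a product of divisor lines and lifted Weil lines of `B`, algebraic given Markman's
FOURFOLD theorem).  Pattern: gen 18's `Census/OcticCurveFourfoldParts.lean` (there the Weil part used the curve twice).
[cite: Pohlmann1968, Thm 1] [cite: GaoUllmo2025, Thm 3.1] [cite: MoonenZarhin1995Duke, Thm. 2.4]
[cite: Gordon1999HodgeAVSurvey, 5.13 (ii)] [cite: Milne2020HodgeClassesAV, 1.2 (a)]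

## References
* [Pohlmann1968] H. Pohlmann, Ann. of Math. 88 (1968), Thm 1.  [GaoUllmo2025] Z. Gao, E. Ullmo, J. Inst. Math. Jussieu
  25 (2025), Thm 3.1.  [MoonenZarhin1995Duke] B. Moonen, Yu. Zarhin, Duke Math. J. 77 (1995), Thm. 2.4.
  [Gordon1999HodgeAVSurvey] B. B. Gordon, CRM Monogr. 10 (1999), 5.13 (ii), 9.2.2.  [Milne2020HodgeClassesAV]
  J. S. Milne, arXiv:2010.08857, 1.2 (a), Thm. 1.
-/

namespace Summit.HodgeConjecture.CorCM.Census.OcticWeilFourfold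

open Finset
open Summit.HodgeConjecture.CorCM.Census.OcticCurveFourfold (Pt sgn cj cj_inl cj_inr cj_facts fin4_cases
  card_filter_mem_eq_sum card_eq_sum sum_pt IsPairPart exists_pairPart_of_counts)

variable {α : Type*} {v : α → Pt}

/-! ### The generating parts: conjugate pairs and Weil `4`-sets of `B` -/

/-- **A Weil part of sign `b`**: four points of `T`, one over each of the four labels `inr (a, b)` of `F` of sign `b`,
none elsewhere — a lift of the weight `Σ_a [(a, b)]` of the Weil line `⋀⁴ H¹(B)_b ⊆ W_k(B) ⊗ ℂ`.
[cite: MoonenZarhin1995Duke, Thm. 2.4] [cite: Gordon1999HodgeAVSurvey, 5.13 (ii)] -/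
def IsWeil₂Part (v : α → Pt) (b : Bool) (G : Finset α) : Prop :=
  G.card = 4 ∧ ∀ a : Fin 4, (G.filter fun x => v x = Sum.inr (a, b)).card = 1

/-- The count function of a Weil part of sign `b`: `1` on the four `inr (a, b)`, `0` elsewhere. [folklore] -/
theorem IsWeil₂Part.count_eq {b : Bool} {G : Finset α} (hG : IsWeil₂Part v b G) :
    (∀ c : Bool, (G.filter fun x => v x = Sum.inl c).card = 0) ∧
      ∀ q : Fin 4 × Bool, (G.filter fun x => v x = Sum.inr q).card = if q.2 = b then 1 else 0 := by
  obtain ⟨hcard, hB⟩ := hG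
  have htot := card_eq_sum v G
  rw [sum_pt, hcard] at htot
  have hB0 := hB 0; have hB1 := hB 1; have hB2 := hB 2; have hB3 := hB 3
  cases b
  · rw [hB0, hB1, hB2, hB3] at htot
    refine ⟨fun c => ?_, fun q => ?_⟩
    · cases c <;> omega
    · obtain ⟨a, c⟩ := q
      rcases fin4_cases a with rfl | rfl | rfl | rfl <;> cases c <;>
        simp only [Fin.isValue, Bool.true_eq_false, ↓reduceIte, hB0, hB1, hB2, hB3] <;> omega
  · rw [hB0, hB1, hB2, hB3] at htot
    refine ⟨fun c => ?_, fun q => ?_⟩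
    · cases c <;> omega
    · obtain ⟨a, c⟩ := q
      rcases fin4_cases a with rfl | rfl | rfl | rfl <;> cases c <;>
        simp only [Fin.isValue, Bool.false_eq_true, ↓reduceIte, hB0, hB1, hB2, hB3] <;> omega

/-- **A pair part is balanced** (for the twelve `(2,2)` equations as well). [cite: Gordon1999HodgeAVSurvey, 9.2.2] -/
theorem isPairPart_modelBalanced₂ [DecidableEq α] {G : Finset α} (hG : IsPairPart v G) : ModelBalanced₂ v G := by
  obtain ⟨y, hy⟩ := hG.count_eq
  rw [modelBalanced₂_iff_counts]
  simp only [hy]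
  have key : ∀ y : Pt, ∀ a b : Fin 4, a ≠ b → 2 * ∑ z ∈ phi₂Pre a b, (if z = y ∨ z = cj y then 1 else 0) =
      ∑ z : Pt, (if z = y ∨ z = cj y then 1 else 0) := by decide +kernel
  exact key y

/-- **A Weil part is balanced** (the Weil line of `B` is a Hodge class: `k`-signature `(2,2)`).
[cite: MoonenZarhin1995Duke, Thm. 2.4] [cite: Gordon1999HodgeAVSurvey, 5.13 (ii)] -/
theorem IsWeil₂Part.modelBalanced₂ {b : Bool} {G : Finset α} (hG : IsWeil₂Part v b G) : ModelBalanced₂ v G := by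
  classical
  obtain ⟨hc, hq⟩ := hG.count_eq
  have hN : ∀ z : Pt, (G.filter fun x => v x = z).card =
      Sum.elim (fun _ => 0) (fun q : Fin 4 × Bool => if q.2 = b then 1 else 0) z := by
    rintro (c | q)
    · exact hc c
    · exact hq q
  rw [modelBalanced₂_iff_counts]
  simp only [hN]
  have key : ∀ b : Bool, ∀ a a' : Fin 4, a ≠ a' →
      2 * ∑ z ∈ phi₂Pre a a', Sum.elim (fun _ => 0) (fun q : Fin 4 × Bool => if q.2 = b then 1 else 0) z =
        ∑ z : Pt, Sum.elim (fun _ => 0) (fun q : Fin 4 × Bool => if q.2 = b then 1 else 0) z := by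
    decide +kernel
  exact key b

/-- A Weil part is non-empty. [folklore] -/
theorem IsWeil₂Part.nonempty {b : Bool} {G : Finset α} (hG : IsWeil₂Part v b G) : G.Nonempty := by
  rw [← Finset.card_pos, hG.1]; norm_num

/-- Every point of a Weil part of sign `b` lies over a fourfold label of sign `b`. [folklore] -/
theorem IsWeil₂Part.exists_eq_inr {b : Bool} {G : Finset α} (hG : IsWeil₂Part v b G) {x : α} (hx : x ∈ G) :
    ∃ a : Fin 4, v x = Sum.inr (a, b) := by
  obtain ⟨hc, hq⟩ := hG.count_eq
  have hpos : 0 < (G.filter fun x' => v x' = v x).card := Finset.card_pos.2 ⟨x, Finset.mem_filter.2 ⟨hx, rfl⟩⟩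
  rcases hvx : v x with c | ⟨a, c⟩
  · rw [hvx, hc c] at hpos
    exact absurd hpos (lt_irrefl 0)
  · rw [hvx, hq (a, c)] at hpos
    refine ⟨a, ?_⟩
    by_cases h : c = b
    · rw [h]
    · rw [if_neg h] at hpos
      exact absurd hpos (lt_irrefl 0)

/-- In a Weil part, two points with the same label coincide (one point over each label of sign `b`); so the model map is
injective on a Weil part. [folklore] -/
theorem IsWeil₂Part.injOn {b : Bool} {G : Finset α} (hG : IsWeil₂Part v b G) : Set.InjOn v ↑G := by
  intro x hx x' hx' hxx'
  obtain ⟨a, ha⟩ := hG.exists_eq_inr (Finset.mem_coe.1 hx)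
  have h1 := hG.2 a
  rw [Finset.card_eq_one] at h1
  obtain ⟨z, hz⟩ := h1
  have hxz : x ∈ G.filter fun x => v x = Sum.inr (a, b) := Finset.mem_filter.2 ⟨Finset.mem_coe.1 hx, ha⟩
  have hx'z : x' ∈ G.filter fun x => v x = Sum.inr (a, b) :=
    Finset.mem_filter.2 ⟨Finset.mem_coe.1 hx', by rw [← hxx', ha]⟩
  rw [hz, Finset.mem_singleton] at hxz hx'z
  rw [hxz, hx'z]

/-- The model image of a Weil part of sign `b` is the set of the four labels `inr (a, b)`. [folklore] -/
theorem IsWeil₂Part.image_eq [DecidableEq α] {b : Bool} {G : Finset α} (hG : IsWeil₂Part v b G) :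
    G.image v = (univ : Finset (Fin 4)).image fun a => (Sum.inr (a, b) : Pt) := by
  ext y
  simp only [Finset.mem_image, Finset.mem_univ, true_and]
  constructor
  · rintro ⟨x, hx, rfl⟩
    obtain ⟨a, ha⟩ := hG.exists_eq_inr hx
    exact ⟨a, ha.symm⟩
  · rintro ⟨a, rfl⟩
    have h1 := hG.2 a
    obtain ⟨z, hz⟩ := Finset.card_eq_one.1 h1
    have hz' : z ∈ G.filter fun x => v x = Sum.inr (a, b) := by rw [hz]; exact Finset.mem_singleton_self z
    exact ⟨z, (Finset.mem_filter.1 hz').1, (Finset.mem_filter.1 hz').2⟩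

/-! ### Extraction of a generating part -/

/-- A Weil part inside `T` from the counts: one point over each `inr (a, b)`. [folklore] -/
theorem exists_weil₂Part_of_counts [DecidableEq α] {T : Finset α} (b : Bool)
    (hB : ∀ a : Fin 4, 0 < (T.filter fun x => v x = Sum.inr (a, b)).card) : ∃ G ⊆ T, IsWeil₂Part v b G := by
  have hpick : ∀ a : Fin 4, ∃ x ∈ T, v x = Sum.inr (a, b) := fun a => by
    obtain ⟨x, hx⟩ := Finset.card_pos.1 (hB a)
    exact ⟨x, (Finset.mem_filter.1 hx).1, (Finset.mem_filter.1 hx).2⟩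
  choose pick hpickT hpickv using hpick
  have hpinj : Function.Injective pick := fun a a' h => by
    have e := hpickv a
    rw [h, hpickv a'] at e
    exact (Prod.mk.inj (Sum.inr_injective e)).1.symm
  refine ⟨univ.image pick, fun x hx => by obtain ⟨a, -, rfl⟩ := Finset.mem_image.1 hx; exact hpickT a, ?_, fun a => ?_⟩
  · rw [Finset.card_image_of_injective _ hpinj, Finset.card_univ, Fintype.card_fin]
  · rw [Finset.card_eq_one]
    refine ⟨pick a, ?_⟩
    ext x
    simp only [Finset.mem_filter, Finset.mem_image, Finset.mem_univ, true_and, Finset.mem_singleton]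
    constructor
    · rintro ⟨⟨a', rfl⟩, hvx⟩
      rw [hpickv a'] at hvx
      rw [(Prod.mk.inj (Sum.inr_injective hvx)).1]
    · rintro rfl
      exact ⟨⟨a, rfl⟩, hpickv a⟩

/-- **EXTRACTION.**  A non-empty balanced configuration contains a pair part or a Weil part: by the defect law, if `t > 0`
then every `N(inr (a, true)) ≥ 1` (a Weil part of sign `true`), if `t < 0` symmetrically (sign `false`), and if `t = 0`
the conjugate of any hit label is hit — as is always the case on the curve — (a pair part).
[cite: Milne2020HodgeClassesAV, 1.2 (a) and Thm. 1] [cite: Gordon1999HodgeAVSurvey, 5.13 (ii)] -/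
theorem exists_part_of_modelBalanced₂ [DecidableEq α] {T : Finset α} (hT : ModelBalanced₂ v T) (hne : T.Nonempty) :
    ∃ G ⊆ T, IsPairPart v G ∨ ∃ b, IsWeil₂Part v b G := by
  obtain ⟨hEE, t, hBt⟩ := exists_defect₂_of_modelBalanced₂ hT
  by_cases ht : 0 < t
  · obtain ⟨G, hG, hW⟩ := exists_weil₂Part_of_counts (v := v) (T := T) true fun a => by have h := hBt a; omega
    exact ⟨G, hG, Or.inr ⟨true, hW⟩⟩
  by_cases ht' : t < 0
  · obtain ⟨G, hG, hW⟩ := exists_weil₂Part_of_counts (v := v) (T := T) false fun a => by have h := hBt a; omega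
    exact ⟨G, hG, Or.inr ⟨false, hW⟩⟩
  have ht0 : t = 0 := by omega
  subst ht0
  obtain ⟨x, hx⟩ := hne
  have hNx : 0 < (T.filter fun x' => v x' = v x).card := Finset.card_pos.2 ⟨x, Finset.mem_filter.2 ⟨hx, rfl⟩⟩
  have hNcx : 0 < (T.filter fun x' => v x' = cj (v x)).card := by
    rcases hvx : v x with c | ⟨a, c⟩ <;> rw [hvx] at hNx
    · cases c
      · rw [cj_inl, Bool.not_false]; omega
      · rw [cj_inl, Bool.not_true]; omega
    · have h := hBt a
      cases c
      · rw [cj_inr, Bool.not_false]; omega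
      · rw [cj_inr, Bool.not_true]; omega
  obtain ⟨G, hG, hP⟩ := exists_pairPart_of_counts (y := v x) hNx hNcx
  exact ⟨G, hG, Or.inl hP⟩

/-! ### The induction principle -/

/-- **INDUCTION PRINCIPLE FOR BALANCED CONFIGURATIONS (any number of copies of `B` and `E`).**  Let `motive` hold for the
empty configuration and pass from `R` to `G ∪ R` whenever `G` is disjoint from `R` and is a pair part or a Weil part.  Then
`motive` holds for every balanced configuration. [cite: Milne2020HodgeClassesAV, 1.2 (a) and Thm. 1] [cite: GaoUllmo2025, Thm 3.1] -/
theorem modelBalanced₂_induction [DecidableEq α] {motive : Finset α → Prop} (h0 : motive ∅)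
    (hpair : ∀ G R : Finset α, Disjoint G R → IsPairPart v G → motive R → motive (G ∪ R))
    (hweil : ∀ (G R : Finset α) (b : Bool), Disjoint G R → IsWeil₂Part v b G → motive R → motive (G ∪ R))
    {T : Finset α} (hT : ModelBalanced₂ v T) : motive T := by
  induction T using Finset.strongInduction with
  | H T ih =>
    by_cases hTe : T = ∅
    · subst hTe; exact h0
    obtain ⟨G, hGT, hG⟩ := exists_part_of_modelBalanced₂ hT (Finset.nonempty_iff_ne_empty.2 hTe)
    rcases hG with hP | ⟨b, hW⟩
    · have hR : ModelBalanced₂ v (T \ G) := hT.sdiff (isPairPart_modelBalanced₂ hP) hGT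
      have hlt : T \ G ⊂ T := Finset.sdiff_ssubset hGT hP.nonempty
      have h := hpair G (T \ G) Finset.disjoint_sdiff hP (ih _ hlt hR)
      rwa [Finset.union_sdiff_of_subset hGT] at h
    · have hR : ModelBalanced₂ v (T \ G) := hT.sdiff hW.modelBalanced₂ hGT
      have hlt : T \ G ⊂ T := Finset.sdiff_ssubset hGT hW.nonempty
      have h := hweil G (T \ G) b Finset.disjoint_sdiff hW (ih _ hlt hR)
      rwa [Finset.union_sdiff_of_subset hGT] at h

end Summit.HodgeConjecture.CorCM.Census.OcticWeilFourfold
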